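import Summits.AtomisticToContinuum.Crystallization.Theorems.GappedShellCensusCleanLimitsHaveWindowsCleanChartTSteps1
import Summits.AtomisticToContinuum.Crystallization.Theorems.GappedShellCensusCleanLimitsHaveWindowsCleanChartTSteps2
import Summits.AtomisticToContinuum.Crystallization.Theorems.GappedShellCensusCleanLimitsHaveWindowsCleanChartTSteps6
import Summits.AtomisticToContinuum.Crystallization.Theorems.GappedShellCensusCleanLimitsHaveWindowsCleanChartTLower
import Summits.AtomisticToContinuum.Crystallization.Theorems.GappedShellCensusCleanLimitsHaveWindowsCleanChartTVinv
import Summits.AtomisticToContinuum.Crystallization.Theorems.GappedShellCensusCleanLimitsHaveWindowsCleanChartTAttach1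
import Summits.AtomisticToContinuum.Crystallization.Theorems.PalmUnimodularRigidityShellsToBarlowChartTransportAttach2

/-!
# `CleanLimitsHaveWindows` (stmt-AtomisticToContinuum-15932), line `Sketch` — stub K1 (`stub_cleanChart`):
# the transport development re-run on CLEAN charts — copy of `PalmUnimodularRigidityShellsToBarlowChartTransportAttach2`

This file is a mechanical copy of `Theorems/PalmUnimodularRigidityShellsToBarlowChartTransportAttach2.lean` (crux `ShellsToBarlowChart`,
route `PalmUnimodularRigidity`; original title: Line `develop-the-model-growth-descent` (crux `ShellsToBarlowChart`, stmt-AtomisticToContinuum-9227): swap symmetry and the attachment of transported caps (part 2/2))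
in which the chart hypothesis `hch : ∀ z ∈ S, IsZChart S z (ac z) (Pc z) (Ac z) (nb z)` (integer charts with
`1 %` closeness) is replaced by the CLEAN-CHART hypothesis: at every site a labelling of the bonded neighbours
by `fcc3Int`/`hcpInt`, bijective, with bonds among neighbours = label pairs at squared distance `18`, together
with the TRANSFER property across every bond (proved for clean sets at matching radius `1/5` in
`…CleanChartTransfer`).  The original development uses its metric hypothesis only through the transfer
lemma, so all proofs go through verbatim; declarations live in the sub-namespace `….Clean` and shadow the
originals, the `hch`-free lemmas of the original file are reused, not restated.  All `[folklore]`.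
-/

noncomputable section

namespace Summit.AtomisticToContinuum.Crystallization.Theorems.PalmUnimodularRigidityShellsToBarlowChart.Clean

open Literature.Geometry.DiscreteGeometry Literature.MathematicalPhysics.StatisticalMechanics
open Summit.AtomisticToContinuum.Crystallization.Theorems.ShellsToBarlowChartNegative

variable {S : Set (EuclideanSpace ℝ (Fin 3))} {Pc : (EuclideanSpace ℝ (Fin 3)) → Finset (Fin 3 → ℤ)}
  {nb : (EuclideanSpace ℝ (Fin 3)) → (Fin 3 → ℤ) → (EuclideanSpace ℝ (Fin 3))}

/-- **Lower attachment across I, letter below `+1`**: the letter read below is preserved by the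
I-step, and the lower apex site of `Ix` is the neighbour of `x` labelled `d + t₁` (`d` the lower
apex of `x`): in the model, `(k−1, i+1, j)` is a lower neighbour of `(k, i, j)`. [folklore] -/
theorem attach_lower_I_pos (hch : ((∀ z ∈ S, (Pc z = fcc3Int ∨ Pc z = hcpInt) ∧ Set.BijOn (nb z) (↑(Pc z) : Set (Fin 3 → ℤ)) {y | y ∈ S ∧ (0 < dist z y ∧ dist z y ≤ 28 / 25)} ∧ (∀ t ∈ Pc z, ∀ t' ∈ Pc z, ((0 < dist (nb z t) (nb z t') ∧ dist (nb z t) (nb z t') ≤ 28 / 25) ↔ sqNormInt (t - t') = 18))) ∧ (∀ x ∈ S, ∀ y ∈ S, (0 < dist x y ∧ dist x y ≤ 28 / 25) → ∀ t ∈ Pc x, ∀ t' ∈ Pc x, ∀ u ∈ Pc y, ∀ u' ∈ Pc y, nb y u = nb x t → nb y u' = nb x t' → sqNormInt (u - u') = sqNormInt (t - t')))) {x : (EuclideanSpace ℝ (Fin 3))} (hx : x ∈ S) {t₁ t₂ : Fin 3 → ℤ} {U : Finset (Fin 3 → ℤ)} (hU : IsFrame (Pc x) t₁ t₂ U) (hlp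 : lowerParity t₁ t₂ (lowerCap (Pc x) t₁ t₂ U) = 1) (hreg : Pc (nb x t₁) = fcc3Int ∨ Pc x = hcpInt ∨ (-zlab Pc nb (nb x t₁) x ∈ Pc (nb x t₁) ∧ -zlab Pc nb (nb x t₁) (nb x t₂) ∈ Pc (nb x t₁))) : lowerParity (Istep Pc nb ⟨x, t₁, t₂, U⟩).t₁ (Istep Pc nb ⟨x, t₁, t₂, U⟩).t₂ (lowerCap (Pc (nb x t₁)) (Istep Pc nb ⟨x, t₁, t₂, U⟩).t₁ (Istep Pc nb ⟨x, t₁, t₂, U⟩).t₂ (Istep Pc nb ⟨x, t₁, t₂, U⟩).U) = 1 ∧ nb (nb x t₁) (apexOf (Istep Pc nb ⟨x, t₁, t₂, U⟩).t₁ (Istep Pc nb ⟨x, t₁, t₂, U⟩).t₂ (lowerCap (Pc (nb x t₁)) (Istep Pc nb ⟨x, t₁, t₂, U⟩).t₁ (Istep Pc nb ⟨x, t₁, t₂, U⟩).t₂ (Istep Pc nb ⟨x, t₁, t₂, U⟩).U)) = nb x (apexOf t₁ t₂ (lowerCap (Pc x) t₁ t₂ U) + t₁) ∧ zlab Pc nb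 (nb x t₁) (nb x (apexOf t₁ t₂ (lowerCap (Pc x) t₁ t₂ U) + t₁)) = apexOf (Istep Pc nb ⟨x, t₁, t₂, U⟩).t₁ (Istep Pc nb ⟨x, t₁, t₂, U⟩).t₂ (lowerCap (Pc (nb x t₁)) (Istep Pc nb ⟨x, t₁, t₂, U⟩).t₁ (Istep Pc nb ⟨x, t₁, t₂, U⟩).t₂ (Istep Pc nb ⟨x, t₁, t₂, U⟩).U) := by
  obtain ⟨ℓ, -, -, hfiltL, hbz, Dlw, hlamL⟩ := Istep_lower hch hx hU hreg
  obtain ⟨hyS, hbxy, hwP, hwx, hvP, hvnb, -, -, -, -, -, hframe, -, -⟩ := Istep_spec hch hx hU hreg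
  have hPx := pattern_cases hch hx
  have hPy := pattern_cases hch hyS
  obtain ⟨h12, hhex, -, -, -⟩ := id hU
  have ht₁ : t₁ ∈ Pc x := hhex (mem_hexLabels_iff.2 (Or.inl rfl))
  have ht₂ : t₂ ∈ Pc x := hhex (mem_hexLabels_iff.2 (Or.inr (Or.inl rfl)))
  obtain ⟨hdL, hdP, hdhex, hd1, hd2, hLeq⟩ := pos_form_of_lowerParity hPx hU hlp
  set d := apexOf t₁ t₂ (lowerCap (Pc x) t₁ t₂ U) with hd_def
  have hℓ : ℓ = d + t₁ := by
    have h1 := (filter_oddCap (Pc x) hPx t₁ ht₁ t₂ ht₂ d hdP h12 hhex hdhex hd1 hd2).1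
    rw [← hLeq, hfiltL] at h1
    exact Finset.singleton_injective h1
  rw [hℓ] at hbz Dlw hlamL
  have hlam := zlab_spec hch hyS (nb_mem hch hx hd1).1 hbz
  -- `D(lam, v) = 36` by transfer (`v` = label of `nb x t₂`)
  have hbJ : 0 < dist (nb x t₁) (nb x t₂) ∧ dist (nb x t₁) (nb x t₂) ≤ 28 / 25 :=
    (bond_nb_iff hch hx ht₁ ht₂).2 h12
  have Dlv : sqNormInt (zlab Pc nb (nb x t₁) (nb x (d + t₁)) - zlab Pc nb (nb x t₁) (nb x t₂)) = 36 := by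
    rw [transfer_nb_nb hch hx hyS hbxy hd1 ht₂ hbz hbJ]
    exact (dist_oddCap_ca (Pc x) hPx t₁ ht₁ t₂ ht₂ d hdP h12 hhex hdhex hd1 hd2).2.1
  -- the new frame and its lower cap
  set a' := (Istep Pc nb ⟨x, t₁, t₂, U⟩).t₁ with ha'
  set b' := (Istep Pc nb ⟨x, t₁, t₂, U⟩).t₂ with hb'
  set U' := (Istep Pc nb ⟨x, t₁, t₂, U⟩).U with hU'
  obtain ⟨h12', hhex', -, -, -⟩ := id hframe
  have ha'P : a' ∈ Pc (nb x t₁) := hhex' (mem_hexLabels_iff.2 (Or.inl rfl))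
  have hb'P : b' ∈ Pc (nb x t₁) := hhex' (mem_hexLabels_iff.2 (Or.inr (Or.inl rfl)))
  have hva : zlab Pc nb (nb x t₁) (nb x t₂) = b' - a' := by
    show zlab Pc nb (nb x t₁) (nb x t₂) =
      (zlab Pc nb (nb x t₁) (nb x t₂) - zlab Pc nb (nb x t₁) x) - -zlab Pc nb (nb x t₁) x
    abel
  have Dla : sqNormInt (zlab Pc nb (nb x t₁) (nb x (d + t₁)) + a') = 18 := by
    show sqNormInt (zlab Pc nb (nb x t₁) (nb x (d + t₁)) + -zlab Pc nb (nb x t₁) x) = 18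
    rw [← sub_eq_add_neg]; exact Dlw
  rw [hva] at Dlv
  obtain ⟨d', hd'L, hd'P, hd'hex, hcase⟩ := lowerCap_cases hPy hframe
  rcases hcase with ⟨hLeq', hlp', hd1', hd2'⟩ | ⟨hLeq', hlp', hd1', hd2'⟩
  · -- letter `+1` again: `lam = d'` is the lower apex of `Ix`
    have hlam' : zlab Pc nb (nb x t₁) (nb x (d + t₁)) = d' := by
      have h1 := (filter_oddCap (Pc (nb x t₁)) hPy a' ha'P b' hb'P d' hd'P h12' hhex' hd'hex hd1' hd2').2.2.1
      rw [← hLeq'] at h1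
      have hmem : zlab Pc nb (nb x t₁) (nb x (d + t₁)) ∈
          (lowerCap (Pc (nb x t₁)) a' b' U').filter (fun e => sqNormInt (e + a') = 18) :=
        Finset.mem_filter.2 ⟨hlamL, Dla⟩
      rw [h1] at hmem
      exact Finset.mem_singleton.1 hmem
    have hapex' : apexOf a' b' (lowerCap (Pc (nb x t₁)) a' b' U') = d' :=
      apexOf_eq_of_form hPy (isFrame_lowerCap hPy hframe) hd'L (Or.inr hLeq')
    rw [hapex']
    exact ⟨hlp', by rw [← hlam']; exact hlam.2, hlam'⟩
  · -- letter `−1` is impossible: `lam = d' − a'` would touch `v = b' − a'`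
    exfalso
    have hlam' : zlab Pc nb (nb x t₁) (nb x (d + t₁)) = d' - a' := by
      have h1 := (filter_evenCap (Pc (nb x t₁)) hPy a' ha'P b' hb'P d' hd'P h12' hhex' hd'hex hd1' hd2').2.2.1
      rw [← hLeq'] at h1
      have hmem : zlab Pc nb (nb x t₁) (nb x (d + t₁)) ∈
          (lowerCap (Pc (nb x t₁)) a' b' U').filter (fun e => sqNormInt (e + a') = 18) :=
        Finset.mem_filter.2 ⟨hlamL, Dla⟩
      rw [h1] at hmem
      exact Finset.mem_singleton.1 hmem
    rw [hlam', show d' - a' - (b' - a') = d' - b' by abel] at Dlv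
    have h18 := (dist_evenCap_c (Pc (nb x t₁)) hPy a' ha'P b' hb'P d' hd'P h12' hhex' hd'hex hd1' hd2').2.1
    rw [Dlv] at h18
    norm_num at h18

/-- **Lower attachment across I, letter below `−1`**: the letter read below is preserved by the
I-step, and the lower apex site `nb x d` of `x` is the neighbour of `Ix` labelled `d₊ − t₁₊`:
in the model, `(k−1, i, j)` is the lower neighbour of `(k, i+1, j)` with offset `(1, 0)`.
[folklore] -/
theorem attach_lower_I_neg (hch : ((∀ z ∈ S, (Pc z = fcc3Int ∨ Pc z = hcpInt) ∧ Set.BijOn (nb z) (↑(Pc z) : Set (Fin 3 → ℤ)) {y | y ∈ S ∧ (0 < dist z y ∧ dist z y ≤ 28 / 25)} ∧ (∀ t ∈ Pc z, ∀ t' ∈ Pc z, ((0 < dist (nb z t) (nb z t') ∧ dist (nb z t) (nb z t') ≤ 28 / 25) ↔ sqNormInt (t - t') = 18))) ∧ (∀ x ∈ S, ∀ y ∈ S, (0 < dist x y ∧ dist x y ≤ 28 / 25) → ∀ t ∈ Pc x, ∀ t' ∈ Pc x, ∀ u ∈ Pc y, ∀ u' ∈ Pc y, nb y u = nb x t → nb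 y u' = nb x t' → sqNormInt (u - u') = sqNormInt (t - t')))) {x : (EuclideanSpace ℝ (Fin 3))}
    (hx : x ∈ S) {t₁ t₂ : Fin 3 → ℤ} {U : Finset (Fin 3 → ℤ)} (hU : IsFrame (Pc x) t₁ t₂ U)
    (hlp : lowerParity t₁ t₂ (lowerCap (Pc x) t₁ t₂ U) = -1)
    (hreg : Pc (nb x t₁) = fcc3Int ∨ Pc x = hcpInt ∨
      (-zlab Pc nb (nb x t₁) x ∈ Pc (nb x t₁) ∧ -zlab Pc nb (nb x t₁) (nb x t₂) ∈ Pc (nb x t₁))) :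
    lowerParity (Istep Pc nb ⟨x, t₁, t₂, U⟩).t₁ (Istep Pc nb ⟨x, t₁, t₂, U⟩).t₂
        (lowerCap (Pc (nb x t₁)) (Istep Pc nb ⟨x, t₁, t₂, U⟩).t₁ (Istep Pc nb ⟨x, t₁, t₂, U⟩).t₂
          (Istep Pc nb ⟨x, t₁, t₂, U⟩).U) = -1 ∧
    nb (nb x t₁) (apexOf (Istep Pc nb ⟨x, t₁, t₂, U⟩).t₁ (Istep Pc nb ⟨x, t₁, t₂, U⟩).t₂
        (lowerCap (Pc (nb x t₁)) (Istep Pc nb ⟨x, t₁, t₂, U⟩).t₁ (Istep Pc nb ⟨x, t₁, t₂, U⟩).t₂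
          (Istep Pc nb ⟨x, t₁, t₂, U⟩).U) - (Istep Pc nb ⟨x, t₁, t₂, U⟩).t₁) =
      nb x (apexOf t₁ t₂ (lowerCap (Pc x) t₁ t₂ U)) ∧
    zlab Pc nb (nb x t₁) (nb x (apexOf t₁ t₂ (lowerCap (Pc x) t₁ t₂ U))) =
      apexOf (Istep Pc nb ⟨x, t₁, t₂, U⟩).t₁ (Istep Pc nb ⟨x, t₁, t₂, U⟩).t₂
        (lowerCap (Pc (nb x t₁)) (Istep Pc nb ⟨x, t₁, t₂, U⟩).t₁ (Istep Pc nb ⟨x, t₁, t₂, U⟩).t₂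
          (Istep Pc nb ⟨x, t₁, t₂, U⟩).U) - (Istep Pc nb ⟨x, t₁, t₂, U⟩).t₁ := by
  obtain ⟨ℓ, -, -, hfiltL, hbz, Dlw, hlamL⟩ := Istep_lower hch hx hU hreg
  obtain ⟨hyS, hbxy, hwP, hwx, hvP, hvnb, -, -, -, -, -, hframe, -, -⟩ := Istep_spec hch hx hU hreg
  have hPx := pattern_cases hch hx
  have hPy := pattern_cases hch hyS
  obtain ⟨h12, hhex, -, -, -⟩ := id hU
  have ht₁ : t₁ ∈ Pc x := hhex (mem_hexLabels_iff.2 (Or.inl rfl))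
  have ht₂ : t₂ ∈ Pc x := hhex (mem_hexLabels_iff.2 (Or.inr (Or.inl rfl)))
  obtain ⟨hdL, hdP, hdhex, hd1, hd2, hLeq⟩ := neg_form_of_lowerParity hPx hU hlp
  set d := apexOf t₁ t₂ (lowerCap (Pc x) t₁ t₂ U) with hd_def
  have hℓ : ℓ = d := by
    have h1 := (filter_evenCap (Pc x) hPx t₁ ht₁ t₂ ht₂ d hdP h12 hhex hdhex hd1 hd2).1
    rw [← hLeq, hfiltL] at h1
    exact Finset.singleton_injective h1
  rw [hℓ] at hbz Dlw hlamL
  have hlam := zlab_spec hch hyS (nb_mem hch hx hdP).1 hbz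
  have hbJ : 0 < dist (nb x t₁) (nb x t₂) ∧ dist (nb x t₁) (nb x t₂) ≤ 28 / 25 :=
    (bond_nb_iff hch hx ht₁ ht₂).2 h12
  have Dlv : sqNormInt (zlab Pc nb (nb x t₁) (nb x d) - zlab Pc nb (nb x t₁) (nb x t₂)) = 18 := by
    rw [transfer_nb_nb hch hx hyS hbxy hdP ht₂ hbz hbJ]
    exact (dist_evenCap_c (Pc x) hPx t₁ ht₁ t₂ ht₂ d hdP h12 hhex hdhex hd1 hd2).2.1
  set a' := (Istep Pc nb ⟨x, t₁, t₂, U⟩).t₁ with ha'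
  set b' := (Istep Pc nb ⟨x, t₁, t₂, U⟩).t₂ with hb'
  set U' := (Istep Pc nb ⟨x, t₁, t₂, U⟩).U with hU'
  obtain ⟨h12', hhex', -, -, -⟩ := id hframe
  have ha'P : a' ∈ Pc (nb x t₁) := hhex' (mem_hexLabels_iff.2 (Or.inl rfl))
  have hb'P : b' ∈ Pc (nb x t₁) := hhex' (mem_hexLabels_iff.2 (Or.inr (Or.inl rfl)))
  have hva : zlab Pc nb (nb x t₁) (nb x t₂) = b' - a' := by
    show zlab Pc nb (nb x t₁) (nb x t₂) =
      (zlab Pc nb (nb x t₁) (nb x t₂) - zlab Pc nb (nb x t₁) x) - -zlab Pc nb (nb x t₁) x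
    abel
  have Dla : sqNormInt (zlab Pc nb (nb x t₁) (nb x d) + a') = 18 := by
    show sqNormInt (zlab Pc nb (nb x t₁) (nb x d) + -zlab Pc nb (nb x t₁) x) = 18
    rw [← sub_eq_add_neg]; exact Dlw
  rw [hva] at Dlv
  obtain ⟨d', hd'L, hd'P, hd'hex, hcase⟩ := lowerCap_cases hPy hframe
  rcases hcase with ⟨hLeq', hlp', hd1', hd2'⟩ | ⟨hLeq', hlp', hd1', hd2'⟩
  · -- letter `+1` is impossible: `lam = d'` is at `36` from `b' − a'`
    exfalso
    have hlam' : zlab Pc nb (nb x t₁) (nb x d) = d' := by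
      have h1 := (filter_oddCap (Pc (nb x t₁)) hPy a' ha'P b' hb'P d' hd'P h12' hhex' hd'hex hd1' hd2').2.2.1
      rw [← hLeq'] at h1
      have hmem : zlab Pc nb (nb x t₁) (nb x d) ∈
          (lowerCap (Pc (nb x t₁)) a' b' U').filter (fun e => sqNormInt (e + a') = 18) :=
        Finset.mem_filter.2 ⟨hlamL, Dla⟩
      rw [h1] at hmem
      exact Finset.mem_singleton.1 hmem
    rw [hlam'] at Dlv
    have h36 := (dist_oddCap_c (Pc (nb x t₁)) hPy a' ha'P b' hb'P d' hd'P h12' hhex' hd'hex hd1' hd2').2.2.1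
    rw [Dlv] at h36
    norm_num at h36
  · have hlam' : zlab Pc nb (nb x t₁) (nb x d) = d' - a' := by
      have h1 := (filter_evenCap (Pc (nb x t₁)) hPy a' ha'P b' hb'P d' hd'P h12' hhex' hd'hex hd1' hd2').2.2.1
      rw [← hLeq'] at h1
      have hmem : zlab Pc nb (nb x t₁) (nb x d) ∈
          (lowerCap (Pc (nb x t₁)) a' b' U').filter (fun e => sqNormInt (e + a') = 18) :=
        Finset.mem_filter.2 ⟨hlamL, Dla⟩
      rw [h1] at hmem
      exact Finset.mem_singleton.1 hmem
    have hapex' : apexOf a' b' (lowerCap (Pc (nb x t₁)) a' b' U') = d' :=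
      apexOf_eq_of_form hPy (isFrame_lowerCap hPy hframe) hd'L (Or.inl hLeq')
    rw [hapex']
    exact ⟨hlp', by rw [← hlam']; exact hlam.2, hlam'⟩

/-- **Upper attachment across J, even layer** (from the I-version by the swap symmetry).
[folklore] -/
theorem attach_J_even (hch : ((∀ z ∈ S, (Pc z = fcc3Int ∨ Pc z = hcpInt) ∧ Set.BijOn (nb z) (↑(Pc z) : Set (Fin 3 → ℤ)) {y | y ∈ S ∧ (0 < dist z y ∧ dist z y ≤ 28 / 25)} ∧ (∀ t ∈ Pc z, ∀ t' ∈ Pc z, ((0 < dist (nb z t) (nb z t') ∧ dist (nb z t) (nb z t') ≤ 28 / 25) ↔ sqNormInt (t - t') = 18))) ∧ (∀ x ∈ S, ∀ y ∈ S, (0 < dist x y ∧ dist x y ≤ 28 / 25) → ∀ t ∈ Pc x, ∀ t' ∈ Pc x, ∀ u ∈ Pc y, ∀ u' ∈ Pc y, nb y u = nb x t → nb y u' = nb x t' → sqNormInt (u - u') = sqNormInt (t - t')))) {x : (EuclideanSpace ℝ (Fin 3))}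
    (hx : x ∈ S) {t₁ t₂ : Fin 3 → ℤ} {U : Finset (Fin 3 → ℤ)} (hU : IsFrame (Pc x) t₁ t₂ U)
    (hpar : frameParity t₁ t₂ U = 1)
    (hreg : Pc (nb x t₂) = fcc3Int ∨ Pc x = hcpInt ∨
      (-zlab Pc nb (nb x t₂) x ∈ Pc (nb x t₂) ∧ -zlab Pc nb (nb x t₂) (nb x t₁) ∈ Pc (nb x t₂))) :
    nb (nb x t₂) (apexOf (Jstep Pc nb ⟨x, t₁, t₂, U⟩).t₁ (Jstep Pc nb ⟨x, t₁, t₂, U⟩).t₂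
        (Jstep Pc nb ⟨x, t₁, t₂, U⟩).U - (Jstep Pc nb ⟨x, t₁, t₂, U⟩).t₂) = nb x (apexOf t₁ t₂ U) ∧
    zlab Pc nb (nb x t₂) (nb x (apexOf t₁ t₂ U)) =
      apexOf (Jstep Pc nb ⟨x, t₁, t₂, U⟩).t₁ (Jstep Pc nb ⟨x, t₁, t₂, U⟩).t₂
        (Jstep Pc nb ⟨x, t₁, t₂, U⟩).U - (Jstep Pc nb ⟨x, t₁, t₂, U⟩).t₂ := by
  have hPx := pattern_cases hch hx
  have hU' : IsFrame (Pc x) t₂ t₁ U := isFrame_swap hU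
  have hpar' : frameParity t₂ t₁ U = 1 := by rw [frameParity_swap]; exact hpar
  obtain ⟨h1, h2⟩ := attach_I_even hch hx hU' hpar' hreg
  obtain ⟨-, -, -, -, -, -, -, -, -, -, -, hframe', -⟩ := Istep_spec hch hx hU' hreg
  have hPy := pattern_cases hch (nb_mem hch hx (hU.2.1 (mem_hexLabels_iff.2 (Or.inr (Or.inl rfl))))).1
  have ha : apexOf (Istep Pc nb ⟨x, t₂, t₁, U⟩).t₂ (Istep Pc nb ⟨x, t₂, t₁, U⟩).t₁
      (Istep Pc nb ⟨x, t₂, t₁, U⟩).U = apexOf (Istep Pc nb ⟨x, t₂, t₁, U⟩).t₁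
      (Istep Pc nb ⟨x, t₂, t₁, U⟩).t₂ (Istep Pc nb ⟨x, t₂, t₁, U⟩).U := apexOf_swap hPy hframe'
  rw [apexOf_swap hPx hU] at h1 h2
  rw [Jstep_swap]
  exact ⟨by rw [ha]; exact h1, by rw [ha]; exact h2⟩

/-- **Upper attachment across J, odd layer** (from the I-version by the swap symmetry).
[folklore] -/
theorem attach_J_odd (hch : ((∀ z ∈ S, (Pc z = fcc3Int ∨ Pc z = hcpInt) ∧ Set.BijOn (nb z) (↑(Pc z) : Set (Fin 3 → ℤ)) {y | y ∈ S ∧ (0 < dist z y ∧ dist z y ≤ 28 / 25)} ∧ (∀ t ∈ Pc z, ∀ t' ∈ Pc z, ((0 < dist (nb z t) (nb z t') ∧ dist (nb z t) (nb z t') ≤ 28 / 25) ↔ sqNormInt (t - t') = 18))) ∧ (∀ x ∈ S, ∀ y ∈ S, (0 < dist x y ∧ dist x y ≤ 28 / 25) → ∀ t ∈ Pc x, ∀ t' ∈ Pc x, ∀ u ∈ Pc y, ∀ u' ∈ Pc y, nb y u = nb x t → nb y u' = nb x t' → sqNormInt (u - u') = sqNormInt (t - t')))) {x : (EuclideanSpace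 ℝ (Fin 3))}
    (hx : x ∈ S) {t₁ t₂ : Fin 3 → ℤ} {U : Finset (Fin 3 → ℤ)} (hU : IsFrame (Pc x) t₁ t₂ U)
    (hpar : frameParity t₁ t₂ U = -1)
    (hreg : Pc (nb x t₂) = fcc3Int ∨ Pc x = hcpInt ∨
      (-zlab Pc nb (nb x t₂) x ∈ Pc (nb x t₂) ∧ -zlab Pc nb (nb x t₂) (nb x t₁) ∈ Pc (nb x t₂))) :
    nb (nb x t₂) (apexOf (Jstep Pc nb ⟨x, t₁, t₂, U⟩).t₁ (Jstep Pc nb ⟨x, t₁, t₂, U⟩).t₂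
        (Jstep Pc nb ⟨x, t₁, t₂, U⟩).U) = nb x (apexOf t₁ t₂ U + t₂) ∧
    zlab Pc nb (nb x t₂) (nb x (apexOf t₁ t₂ U + t₂)) =
      apexOf (Jstep Pc nb ⟨x, t₁, t₂, U⟩).t₁ (Jstep Pc nb ⟨x, t₁, t₂, U⟩).t₂
        (Jstep Pc nb ⟨x, t₁, t₂, U⟩).U := by
  have hPx := pattern_cases hch hx
  have hU' : IsFrame (Pc x) t₂ t₁ U := isFrame_swap hU
  have hpar' : frameParity t₂ t₁ U = -1 := by rw [frameParity_swap]; exact hpar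
  obtain ⟨h1, h2⟩ := attach_I_odd hch hx hU' hpar' hreg
  obtain ⟨-, -, -, -, -, -, -, -, -, -, -, hframe', -⟩ := Istep_spec hch hx hU' hreg
  have hPy := pattern_cases hch (nb_mem hch hx (hU.2.1 (mem_hexLabels_iff.2 (Or.inr (Or.inl rfl))))).1
  have ha : apexOf (Istep Pc nb ⟨x, t₂, t₁, U⟩).t₂ (Istep Pc nb ⟨x, t₂, t₁, U⟩).t₁
      (Istep Pc nb ⟨x, t₂, t₁, U⟩).U = apexOf (Istep Pc nb ⟨x, t₂, t₁, U⟩).t₁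
      (Istep Pc nb ⟨x, t₂, t₁, U⟩).t₂ (Istep Pc nb ⟨x, t₂, t₁, U⟩).U := apexOf_swap hPy hframe'
  rw [apexOf_swap hPx hU] at h1 h2
  rw [Jstep_swap]
  exact ⟨by rw [ha]; exact h1, by rw [ha]; exact h2⟩

end Summit.AtomisticToContinuum.Crystallization.Theorems.PalmUnimodularRigidityShellsToBarlowChart.Clean

end
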